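import Summits.Ventures.PackingBounds.Energy.FivePointRieszFourGramDataA2
import Summits.Ventures.PackingBounds.Energy.FivePointRieszFourGramDataB
import Summits.Ventures.PackingBounds.Energy.GramDataCheck
import HarnessLib

/-!
# The 77 × 77 Gram block of the `s = 4`, `d = 6` five-point certificate is positive semidefinite (kernel-checked on data)

Framing: lottery ticket; floor = certified bounds/negative ranges. Venture `PackingBounds`, cell
`pub-packcert`, energy family E3PT (pub-packcert-energy gen 11; KERNEL-D6 route).

`decide +kernel` checks, in seven row chunks, the integer identity `S·Y = L Lᵀ + E` with `E` symmetric
(`GramData.checkRows`) and the diagonal dominance of `E` (`GramData.checkDD`) for the data modules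
`FivePointRieszFourGramDataA1/A2/B` (block `R:1` of `certs/e3pt/e3pt-sharp-n3N5s4d6-none.json`, scaled by
`scaleS`); `GramData.psd_of_checks` then gives `Σ_{i,j<77} (S·Y)_{ij} y_i y_j ≥ 0` for every real `y`
(`RieszFourD6.gram_nonneg`). No polynomial identity is expanded (the `ring` route is infeasible at this size).
-/

namespace Summit.Ventures.PackingBounds.Energy.RieszFourD6

open Summit.Ventures.PackingBounds.Energy.GramData

set_option maxRecDepth 100000 in
/-- Rows 0–10 of `S·Y = L Lᵀ + E`, `E` symmetric (kernel evaluation). -/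
theorem rows_0_11 : checkRows 77 77 0 11 yR lR eR = true := by decide +kernel

set_option maxRecDepth 100000 in
/-- Rows 11–21. -/
theorem rows_11_22 : checkRows 77 77 11 22 yR lR eR = true := by decide +kernel

set_option maxRecDepth 100000 in
/-- Rows 22–32. -/
theorem rows_22_33 : checkRows 77 77 22 33 yR lR eR = true := by decide +kernel

set_option maxRecDepth 100000 in
/-- Rows 33–43. -/
theorem rows_33_44 : checkRows 77 77 33 44 yR lR eR = true := by decide +kernel

set_option maxRecDepth 100000 in
/-- Rows 44–54. -/
theorem rows_44_55 : checkRows 77 77 44 55 yR lR eR = true := by decide +kernel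

set_option maxRecDepth 100000 in
/-- Rows 55–65. -/
theorem rows_55_66 : checkRows 77 77 55 66 yR lR eR = true := by decide +kernel

set_option maxRecDepth 100000 in
/-- Rows 66–76. -/
theorem rows_66_77 : checkRows 77 77 66 77 yR lR eR = true := by decide +kernel

set_option maxRecDepth 100000 in
/-- `E` is diagonally dominant: `Σ_j |E_{ij}| ≤ 2 E_{ii}` for all rows (kernel evaluation). -/
theorem dd_all : checkDD 77 eR = true := by decide +kernel

/-- All rows: `(S·Y)_{ij} = Σ_c L_{ic} L_{jc} + E_{ij}` and `E_{ij} = E_{ji}` for `i, j < 77`. -/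
theorem rows_all : ∀ i j, i < 77 → j < 77 →
    ent yR i j = dotRows lR i j 77 + ent eR i j ∧ ent eR i j = ent eR j i := by
  intro i j hi hj
  by_cases h1 : i < 11
  · exact of_checkRows rows_0_11 i j (Nat.zero_le _) h1 hj
  by_cases h2 : i < 22
  · exact of_checkRows rows_11_22 i j (by omega) h2 hj
  by_cases h3 : i < 33
  · exact of_checkRows rows_22_33 i j (by omega) h3 hj
  by_cases h4 : i < 44
  · exact of_checkRows rows_33_44 i j (by omega) h4 hj
  by_cases h5 : i < 55
  · exact of_checkRows rows_44_55 i j (by omega) h5 hj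
  by_cases h6 : i < 66
  · exact of_checkRows rows_55_66 i j (by omega) h6 hj
  · exact of_checkRows rows_66_77 i j (by omega) hi hj

/-- **The `77 × 77` Gram block (scaled by `S > 0`) is positive semidefinite**: for every real vector `y`,
`Σ_{i,j<77} (S·Y)_{ij} y_i y_j ≥ 0`. -/
theorem gram_nonneg (y : Fin 77 → ℝ) :
    0 ≤ ∑ i : Fin 77, ∑ j : Fin 77, (ent yR i j : ℝ) * y i * y j :=
  psd_of_checks 77 77 yR lR eR rows_all (of_checkDD dd_all) y

end Summit.Ventures.PackingBounds.Energy.RieszFourD6
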